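/-
Copyright (c) 2026. All rights reserved.
Released under Apache 2.0 license as described in the file LICENSE.
-/
import Mathlib
import Summits.MatrixMultiplication.MatrixMultiplication.Theorems.SubgroupIdentityDesigns.Negative.ExceptionalParity
import Summits.MatrixMultiplication.MatrixMultiplication.Theorems.SubgroupIdentityDesigns.Negative.CartanMembers

/-!
# The exceptional member of a `(2,1)` witness, and the volume cut it implies

Route `LevelGradedCohnUmans`, crux `SubgroupIdentityDesigns` (stmt-MatrixMultiplication-14079), the
`(m,k) = (2,1)` cell.  VALUE = THEOREM / DECIDABLE VERDICT on one cell, NOT summit progress: the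
crux quantifies over all `(p, m, k)` and stays open.

Structure theorem for a hypothetical `(2,1)` witness `(H₁, H₂, H₃)` at a prime `p ≥ 7`
(`0 < ε ≤ 1`), combining `CartanMembers` (some member is conjugate into no Cartan normaliser),
`dickson_sharp` (parity law + exact image order) and `ScalarLaw.neg_one_mem_atMostOne`:

* `levelOne_witness_exceptional_member`: exactly the shape the order sieve uses — some member `H`
  contains `-1` and has `|H| = |H ∩ Z| · N`, `N ∈ {12, 24, 60}`, `N ∣ (p-1)(p+1)`;
* `card_le_of_neg_one_not_mem`: a `p`-free member with a free vector and WITHOUT `-1` has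
  `|H| ≤ |H ∩ Z| · (p + 1)` (it is of Cartan type);
* `levelOne_witness_exceptional_volume`: hence `1 + p³ + (p-2)(p+1)³ < (p-1) · N · (p+1)²` for
  that `N` — so `N = 12 ⇒ p ≤ 11`, `N = 24 ⇒ p ≤ 23`, `N = 60 ⇒ p ≤ 59 ∧ p ≡ ±1 (5)`;
* `no_levelOne_witness_of_exceptional_volume` + instances: the `(2,1)` cell is EMPTY at
  `p = 37` and `p = 43` (new decidable verdicts; `p ≥ 47` is `DicksonTheorem.cellTwoOne_empty`).

What remains DATA (ORACLE-g16 §G16-2, ORACLE-g17): `p ∈ {5, 7, 11, 13, 17, 19, 23, 29, 31, 41}`.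

Report: `run/shared/lean/b2b/levelgraded-cu/ORACLE-g17.md`.
-/

set_option linter.dupNamespace false

noncomputable section

open scoped BigOperators Classical

open Summit.MatrixMultiplication.MatrixMultiplication.Theorems.LieRankDesigns.Negative (GLm Mat budget)
open Literature.Barriers.MatrixMultiplication (SubgroupTPP)

namespace Summit.MatrixMultiplication.MatrixMultiplication.Theorems.SubgroupIdentityDesigns.Negative

section ExceptionalMember

variable {p : ℕ} [hp : Fact p.Prime]

/-! ### Members without `-1` are of Cartan type -/

/-- A `p`-free subgroup with a free vector that does NOT contain `-1` is of Cartan type, hence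
its projective image has order `≤ p + 1`. -/
theorem image_le_of_neg_one_not_mem (hp3 : 3 ≤ p) {n : ZMod p} (hn : ∀ x : ZMod p, x * x ≠ n)
    {H : Subgroup (GLm p 2)} (hH : ¬ p ∣ Nat.card H)
    (hfree : ∃ a : Fin 2 → ZMod p, a ≠ 0 ∧
      ∀ h ∈ H, ((h : GLm p 2) : Mat p 2).mulVec a = a → h = 1)
    (hneg : scalarHom p 2 (-1) ∉ H) :
    Nat.card (H.map (QuotientGroup.mk' (scalarHom p 2).range)) ≤ p + 1 := by
  have hp2 : p ≠ 2 := by omega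
  rcases dickson_sharp hp2 hn hH with ⟨g, hg⟩ | ⟨g, hg⟩ | ⟨hmem, -⟩
  · exact image_le_of_conj_monomial hp3 hg hfree
  · exact image_le_of_conj_singerNormal hp3 hn hg hfree
  · exact absurd hmem hneg

/-- Hence `|H| ≤ |H ∩ Z| · (p + 1)` for such a member. -/
theorem card_le_of_neg_one_not_mem (hp3 : 3 ≤ p) {n : ZMod p} (hn : ∀ x : ZMod p, x * x ≠ n)
    {H : Subgroup (GLm p 2)} (hH : ¬ p ∣ Nat.card H)
    (hfree : ∃ a : Fin 2 → ZMod p, a ≠ 0 ∧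
      ∀ h ∈ H, ((h : GLm p 2) : Mat p 2).mulVec a = a → h = 1)
    (hneg : scalarHom p 2 (-1) ∉ H) :
    Nat.card H ≤ Nat.card (H.comap (scalarHom p 2)) * (p + 1) := by
  rw [card_eq_scalar_mul_card_image H]
  exact Nat.mul_le_mul_left _ (image_le_of_neg_one_not_mem hp3 hn hH hfree hneg)

/-- A subgroup containing `-1` has even scalar part (`-1 ∈ H ∩ Z` has order `2`). -/
theorem two_dvd_card_comap_of_neg_one_mem (hp2 : p ≠ 2) {H : Subgroup (GLm p 2)}
    (hmem : scalarHom p 2 (-1) ∈ H) : 2 ∣ Nat.card (H.comap (scalarHom p 2)) := by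
  have hu : (-1 : (ZMod p)ˣ) ∈ H.comap (scalarHom p 2) := Subgroup.mem_comap.mpr hmem
  have hord : orderOf (-1 : (ZMod p)ˣ) = 2 :=
    orderOf_eq_prime (by rw [neg_one_sq]) (neg_one_ne_one_units hp2)
  have h2 := Subgroup.orderOf_dvd_natCard _ hu
  rwa [hord] at h2

/-! ### The projective image order divides `(p-1)(p+1)` -/

/-- The order of `GL₂(𝔽_p) / Z`. -/
theorem card_quotient_scalar :
    Nat.card (GLm p 2 ⧸ (scalarHom p 2).range) = p * ((p - 1) * (p + 1)) := by
  have h := Subgroup.card_eq_card_quotient_mul_card_subgroup ((scalarHom p 2).range)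
  rw [card_range_scalarHom, card_GL2'] at h
  have hp1 : 0 < p - 1 := by have := hp.out.two_le; omega
  have h' : p * ((p - 1) * (p + 1)) * (p - 1) =
      Nat.card (GLm p 2 ⧸ (scalarHom p 2).range) * (p - 1) := by
    rw [← h]; ring
  exact (Nat.eq_of_mul_eq_mul_right hp1 h').symm

/-- For a `p`-free `H` with `|H| = |H ∩ Z| · N` and image order `N`, `N ∣ (p-1)(p+1)`. -/
theorem image_dvd_of_pfree {H : Subgroup (GLm p 2)} (hH : ¬ p ∣ Nat.card H) {N : ℕ}
    (hcard : Nat.card H = Nat.card (H.comap (scalarHom p 2)) * N)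
    (himg : Nat.card (H.map (QuotientGroup.mk' (scalarHom p 2).range)) = N) :
    N ∣ (p - 1) * (p + 1) := by
  have h1 : N ∣ p * ((p - 1) * (p + 1)) := by
    rw [← himg, ← card_quotient_scalar]
    exact Subgroup.card_subgroup_dvd_card _
  have hcop : Nat.Coprime p N := by
    rw [Nat.Prime.coprime_iff_not_dvd hp.out]
    intro hpN
    exact hH (hcard ▸ Dvd.dvd.mul_left hpN _)
  exact hcop.symm.dvd_of_dvd_mul_left h1

/-! ### The exceptional member -/

/-- **The exceptional member of a `(2,1)` witness** (`p ≥ 7`, `0 < ε ≤ 1`): some member `H`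
contains `-1` and has `|H| = |H ∩ Z| · N` with `N ∈ {12, 24, 60}` its exact projective image
order, and `N ∣ (p-1)(p+1)`. -/
theorem levelOne_witness_exceptional_member (hp7 : 7 ≤ p) {n : ZMod p}
    (hn : ∀ x : ZMod p, x * x ≠ n) {ε : ℝ} (hε : 0 < ε) (hε1 : ε ≤ 1)
    {H₁ H₂ H₃ : Subgroup (GLm p 2)} (htpp : SubgroupTPP H₁ H₂ H₃)
    (hdesign : ∃ c : Mat p 2 → ℂ, (∀ M, 1 < M.rank → c M = 0) ∧
      (∑ M, c M * ZMod.stdAddChar (Matrix.trace (M * ((1 : GLm p 2) : Mat p 2)))) = 1 ∧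
      ∀ a ∈ H₁, ∀ b ∈ H₂, ∀ g ∈ H₃, a * b * g ≠ 1 →
        (∑ M, c M *
          ZMod.stdAddChar (Matrix.trace (M * ((a * b * g : GLm p 2) : Mat p 2)))) = 0)
    (hwit : budget p 2 1 (2 + ε) <
      ((Nat.card H₁ * Nat.card H₂ * Nat.card H₃ : ℕ) : ℝ) ^ ((2 + ε) / 3)) :
    ∃ H : Subgroup (GLm p 2), (H = H₁ ∨ H = H₂ ∨ H = H₃) ∧ scalarHom p 2 (-1) ∈ H ∧
      ∃ N : ℕ, (N = 12 ∨ N = 24 ∨ N = 60) ∧ N ∣ (p - 1) * (p + 1) ∧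
        Nat.card H = Nat.card (H.comap (scalarHom p 2)) * N ∧
        Nat.card (H.map (QuotientGroup.mk' (scalarHom p 2).range)) = N := by
  have hp2 : p ≠ 2 := by omega
  obtain ⟨-, hK₁, hK₂, hK₃⟩ := levelOne_witness_pfree_profile (by omega) hε hε1 htpp hdesign hwit
  obtain ⟨H, hH, hnm, hns⟩ := exists_member_not_conj_cartan hp7 hn hε hε1 htpp hdesign hwit
  have hK : ¬ p ∣ Nat.card H := by
    rcases hH with rfl | rfl | rfl
    · exact hK₁
    · exact hK₂
    · exact hK₃
  refine ⟨H, hH, ?_⟩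
  rcases dickson_sharp hp2 hn hK with ⟨g, hg⟩ | ⟨g, hg⟩ | ⟨hmem, N, hN, hcard, himg⟩
  · obtain ⟨x, hx, hxm⟩ := hnm g
    exact absurd (hg x hx) hxm
  · obtain ⟨x, hx, hxs⟩ := hns g
    exact absurd (hg x hx) hxs
  · exact ⟨hmem, N, hN, image_dvd_of_pfree hK hcard himg, hcard, himg⟩

/-! ### The volume cut -/

/-- **Volume profile of a `(2,1)` witness** (`p ≥ 7`, `0 < ε ≤ 1`): with `N ∈ {12, 24, 60}` the
image order of the exceptional member, `N ∣ (p-1)(p+1)` and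
`1 + p³ + (p-2)(p+1)³ < |H₁||H₂||H₃| ≤ (p-1) · (N · (p+1) · (p+1))`. -/
theorem levelOne_witness_exceptional_volume (hp7 : 7 ≤ p) {n : ZMod p}
    (hn : ∀ x : ZMod p, x * x ≠ n) {ε : ℝ} (hε : 0 < ε) (hε1 : ε ≤ 1)
    {H₁ H₂ H₃ : Subgroup (GLm p 2)} (htpp : SubgroupTPP H₁ H₂ H₃)
    (hdesign : ∃ c : Mat p 2 → ℂ, (∀ M, 1 < M.rank → c M = 0) ∧
      (∑ M, c M * ZMod.stdAddChar (Matrix.trace (M * ((1 : GLm p 2) : Mat p 2)))) = 1 ∧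
      ∀ a ∈ H₁, ∀ b ∈ H₂, ∀ g ∈ H₃, a * b * g ≠ 1 →
        (∑ M, c M *
          ZMod.stdAddChar (Matrix.trace (M * ((a * b * g : GLm p 2) : Mat p 2)))) = 0)
    (hwit : budget p 2 1 (2 + ε) <
      ((Nat.card H₁ * Nat.card H₂ * Nat.card H₃ : ℕ) : ℝ) ^ ((2 + ε) / 3)) :
    ∃ N : ℕ, (N = 12 ∨ N = 24 ∨ N = 60) ∧ N ∣ (p - 1) * (p + 1) ∧
      1 + p ^ 3 + (p - 2) * (p + 1) ^ 3 < Nat.card H₁ * Nat.card H₂ * Nat.card H₃ ∧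
      Nat.card H₁ * Nat.card H₂ * Nat.card H₃ ≤ (p - 1) * (N * (p + 1) * (p + 1)) := by
  have hp2 : p ≠ 2 := by omega
  have hp3 : 3 ≤ p := by omega
  obtain ⟨-, hK₁, hK₂, hK₃⟩ := levelOne_witness_pfree_profile hp3 hε hε1 htpp hdesign hwit
  obtain ⟨hF₁, hF₂, hF₃⟩ := levelOne_witness_free_vector hp3 hε hε1 htpp hdesign hwit
  obtain ⟨h12, h13, h23⟩ := neg_one_mem_atMostOne hp2 htpp
  obtain ⟨H, hH, hmem, N, hN, hdvd, hcard, -⟩ :=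
    levelOne_witness_exceptional_member hp7 hn hε hε1 htpp hdesign hwit
  have hfloor : 1 + p ^ 3 + (p - 2) * (p + 1) ^ 3 < Nat.card H₁ * Nat.card H₂ * Nat.card H₃ := by
    by_contra hle
    exact no_levelOne_witness_of_volume_le_nat (by linarith) hε1 (Nat.le_of_not_lt hle) hwit
  refine ⟨N, hN, hdvd, hfloor, ?_⟩
  rcases hH with rfl | rfl | rfl
  · have h₂ := card_le_of_neg_one_not_mem hp3 hn hK₂ hF₂ (fun h => h12 ⟨hmem, h⟩)
    have h₃ := card_le_of_neg_one_not_mem hp3 hn hK₃ hF₃ (fun h => h13 ⟨hmem, h⟩)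
    exact volume_le_of_scalar_index htpp hcard.le h₂ h₃
  · have h₁ := card_le_of_neg_one_not_mem hp3 hn hK₁ hF₁ (fun h => h12 ⟨h, hmem⟩)
    have h₃ := card_le_of_neg_one_not_mem hp3 hn hK₃ hF₃ (fun h => h23 ⟨hmem, h⟩)
    have := volume_le_of_scalar_index htpp h₁ hcard.le h₃
    calc Nat.card H₁ * Nat.card H * Nat.card H₃ ≤ (p - 1) * ((p + 1) * N * (p + 1)) := this
      _ = (p - 1) * (N * (p + 1) * (p + 1)) := by ring
  · have h₁ := card_le_of_neg_one_not_mem hp3 hn hK₁ hF₁ (fun h => h13 ⟨h, hmem⟩)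
    have h₂ := card_le_of_neg_one_not_mem hp3 hn hK₂ hF₂ (fun h => h23 ⟨h, hmem⟩)
    have := volume_le_of_scalar_index htpp h₁ h₂ hcard.le
    calc Nat.card H₁ * Nat.card H₂ * Nat.card H ≤ (p - 1) * ((p + 1) * (p + 1) * N) := this
      _ = (p - 1) * (N * (p + 1) * (p + 1)) := by ring

/-- **The exceptional-volume cut.**  If for every `N ∈ {12, 24, 60}` dividing `(p-1)(p+1)` the
bound `(p-1) · N · (p+1)² ≤ 1 + p³ + (p-2)(p+1)³` holds, there is no `(2,1)` witness at `p`
(`p ≥ 7`, `0 < ε ≤ 1`). -/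
theorem no_levelOne_witness_of_exceptional_volume (hp7 : 7 ≤ p)
    (hP : ∀ N : ℕ, (N = 12 ∨ N = 24 ∨ N = 60) → N ∣ (p - 1) * (p + 1) →
      (p - 1) * (N * (p + 1) * (p + 1)) ≤ 1 + p ^ 3 + (p - 2) * (p + 1) ^ 3)
    {ε : ℝ} (hε : 0 < ε) (hε1 : ε ≤ 1)
    {H₁ H₂ H₃ : Subgroup (GLm p 2)} (htpp : SubgroupTPP H₁ H₂ H₃)
    (hdesign : ∃ c : Mat p 2 → ℂ, (∀ M, 1 < M.rank → c M = 0) ∧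
      (∑ M, c M * ZMod.stdAddChar (Matrix.trace (M * ((1 : GLm p 2) : Mat p 2)))) = 1 ∧
      ∀ a ∈ H₁, ∀ b ∈ H₂, ∀ g ∈ H₃, a * b * g ≠ 1 →
        (∑ M, c M *
          ZMod.stdAddChar (Matrix.trace (M * ((a * b * g : GLm p 2) : Mat p 2)))) = 0) :
    ¬ budget p 2 1 (2 + ε) <
      ((Nat.card H₁ * Nat.card H₂ * Nat.card H₃ : ℕ) : ℝ) ^ ((2 + ε) / 3) := by
  intro hwit
  have hp2 : p ≠ 2 := by omega
  obtain ⟨n, hn⟩ := FiniteField.exists_nonsquare (F := ZMod p) (by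
    rw [ZMod.ringChar_zmod_n]; exact hp2)
  have hn' : ∀ x : ZMod p, x * x ≠ n := fun x hx => hn ⟨x, hx.symm⟩
  obtain ⟨N, hN, hdvd, hfloor, hvol⟩ :=
    levelOne_witness_exceptional_volume hp7 hn' hε hε1 htpp hdesign hwit
  have := hP N hN hdvd
  omega

/-- **The `(2,1)` cell is empty at `p = 37`** (`0 < ε ≤ 1`): `60 ∤ 36 · 38`, and
`36 · 24 · 38² = 1247616 ≤ 1971174`. Decidable verdict, NOT summit progress. -/
theorem cellTwoOne_empty_37 [Fact (Nat.Prime 37)] {ε : ℝ} (hε : 0 < ε) (hε1 : ε ≤ 1)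
    {H₁ H₂ H₃ : Subgroup (GLm 37 2)} (htpp : SubgroupTPP H₁ H₂ H₃)
    (hdesign : ∃ c : Mat 37 2 → ℂ, (∀ M, 1 < M.rank → c M = 0) ∧
      (∑ M, c M * ZMod.stdAddChar (Matrix.trace (M * ((1 : GLm 37 2) : Mat 37 2)))) = 1 ∧
      ∀ a ∈ H₁, ∀ b ∈ H₂, ∀ g ∈ H₃, a * b * g ≠ 1 →
        (∑ M, c M *
          ZMod.stdAddChar (Matrix.trace (M * ((a * b * g : GLm 37 2) : Mat 37 2)))) = 0) :
    ¬ budget 37 2 1 (2 + ε) <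
      ((Nat.card H₁ * Nat.card H₂ * Nat.card H₃ : ℕ) : ℝ) ^ ((2 + ε) / 3) := by
  refine no_levelOne_witness_of_exceptional_volume (by norm_num) ?_ hε hε1 htpp hdesign
  intro N hN hdvd
  rcases hN with rfl | rfl | rfl
  · norm_num
  · norm_num
  · exfalso; revert hdvd; norm_num

/-- **The `(2,1)` cell is empty at `p = 43`** (`0 < ε ≤ 1`): `60 ∤ 42 · 44`, and
`42 · 24 · 44² = 1951488 ≤ 3572052`. Decidable verdict, NOT summit progress. -/
theorem cellTwoOne_empty_43 [Fact (Nat.Prime 43)] {ε : ℝ} (hε : 0 < ε) (hε1 : ε ≤ 1)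
    {H₁ H₂ H₃ : Subgroup (GLm 43 2)} (htpp : SubgroupTPP H₁ H₂ H₃)
    (hdesign : ∃ c : Mat 43 2 → ℂ, (∀ M, 1 < M.rank → c M = 0) ∧
      (∑ M, c M * ZMod.stdAddChar (Matrix.trace (M * ((1 : GLm 43 2) : Mat 43 2)))) = 1 ∧
      ∀ a ∈ H₁, ∀ b ∈ H₂, ∀ g ∈ H₃, a * b * g ≠ 1 →
        (∑ M, c M *
          ZMod.stdAddChar (Matrix.trace (M * ((a * b * g : GLm 43 2) : Mat 43 2)))) = 0) :
    ¬ budget 43 2 1 (2 + ε) <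
      ((Nat.card H₁ * Nat.card H₂ * Nat.card H₃ : ℕ) : ℝ) ^ ((2 + ε) / 3) := by
  refine no_levelOne_witness_of_exceptional_volume (by norm_num) ?_ hε hε1 htpp hdesign
  intro N hN hdvd
  rcases hN with rfl | rfl | rfl
  · norm_num
  · norm_num
  · exfalso; revert hdvd; norm_num

/-- **The `(2,1)` cell is empty for every prime `p ≥ 37` except possibly `p = 41`**
(`0 < ε ≤ 1`): `p ≥ 61` by volume (`N ≤ 60`), `47 ≤ p ≤ 59` by `cellTwoOne_empty`, and
`p = 37, 43` above — packaged uniformly through the exceptional-volume cut for `p ≥ 61` and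
`p ∈ {37, 43, 47, 53}` (`60 ∤ (p-1)(p+1)`), and through `cellTwoOne_empty` for `p = 59`. -/
theorem cellTwoOne_empty_of_ge_37 (hp37 : 37 ≤ p) (hp41 : p ≠ 41) {ε : ℝ} (hε : 0 < ε)
    (hε1 : ε ≤ 1) {H₁ H₂ H₃ : Subgroup (GLm p 2)} (htpp : SubgroupTPP H₁ H₂ H₃)
    (hdesign : ∃ c : Mat p 2 → ℂ, (∀ M, 1 < M.rank → c M = 0) ∧
      (∑ M, c M * ZMod.stdAddChar (Matrix.trace (M * ((1 : GLm p 2) : Mat p 2)))) = 1 ∧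
      ∀ a ∈ H₁, ∀ b ∈ H₂, ∀ g ∈ H₃, a * b * g ≠ 1 →
        (∑ M, c M *
          ZMod.stdAddChar (Matrix.trace (M * ((a * b * g : GLm p 2) : Mat p 2)))) = 0) :
    ¬ budget p 2 1 (2 + ε) <
      ((Nat.card H₁ * Nat.card H₂ * Nat.card H₃ : ℕ) : ℝ) ^ ((2 + ε) / 3) := by
  by_cases hp47 : 47 ≤ p
  · exact cellTwoOne_empty hp47 hε hε1 htpp hdesign
  · -- `37 ≤ p ≤ 46`, `p` prime, `p ≠ 41`: `p = 37` or `p = 43`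
    refine no_levelOne_witness_of_exceptional_volume (by omega) ?_ hε hε1 htpp hdesign
    have hp' := hp.out
    interval_cases p <;> first
      | exact absurd rfl hp41
      | exact absurd hp' (by decide)
      | (intro N hN hdvd
         rcases hN with rfl | rfl | rfl <;>
           first | (norm_num; done) | (exfalso; revert hdvd; norm_num))

end ExceptionalMember

end Summit.MatrixMultiplication.MatrixMultiplication.Theorems.SubgroupIdentityDesigns.Negative

end
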